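import Summits.HubbardSuperconductivity.HubbardSuperconductivity.Theorems.BalabanIRBirGroundStateAverageLRO
import Literature.MathematicalPhysics.QuantumLattice.FinDimSpectrumGibbsLimitProofs

/-!
# Route BalabanIR — crux 4 `BirGappedPhaseReduction` (item `stmt-HubbardSuperconductivity-2082`): the zero-temperature limit of the canonical (sector) Gibbs state

The reduction `BirGappedPhaseReduction := BirComplexStableXY → BirGroundStateAverageLRO` must
deliver a bound on the UNIFORM AVERAGE over the sector ground eigenspace `E₀ = S ⊓ ker (H - e₀)`
from an engine whose natural output is a bound on CANONICAL (sector) thermal averages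
`tr (P_S e^{-βH} A) / tr (P_S e^{-βH})`, uniform in `β` (informal step (3) of the item: "β → ∞ at
fixed even L is M → ∞ at fixed L"). This file proves that `β → ∞` passage in finite dimensions:

* `tendsto_sectorGibbs_atTop` — for a Hermitian `H`, an `H`-invariant subspace `K`, sector energy
  `e₀ = H.minEnergyOn K` and sector ground eigenspace `E₀ = K ⊓ ker (H - e₀) ≠ ⊥`,
  `tr (P_K e^{-βH} A) / tr (P_K e^{-βH}) ⟶ tr (P_{E₀} A) / tr P_{E₀}` as `β → ∞`
  (`P_K`, `P_{E₀}` the orthogonal projections `projMatrix`, `e^{-βH} = Matrix.gibbsWeight β H`);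
* `mul_re_trace_le_of_eventually_sectorGibbs` — an eventual (in `β`) lower bound `c` on the real
  part of the sector Gibbs average gives `c · re tr P_{E₀} ≤ re tr (P_{E₀} A)` (the target's shape).

On the way: `projMatrix_map_mul_eq_mul_of_invariant` (`[P_K, H] = 0`),
`projMatrix_map_mulVec_eq_zero_of_eigenvalue_lt`, `projMatrix_map_mul_conj_diagonal_eq`
(`P_K · 𝟙_{{e₀}}(H) = P_{E₀}`). The whole-space case is the tree's
`Matrix.tendsto_gibbsState_atTop_holds`, whose functional-calculus lines are reused; subspaces
`K ≤ (n → ℂ)` are transported to `EuclideanSpace ℂ n` along `(WithLp.linearEquiv 2 ℂ _).symm`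
(= `Fock.toEuclidean` on Fock spaces), as in the tree's `projMatrix_map_*` lemmas. The Hubbard
specialisation is in `BalabanIRBirGappedPhaseReductionThermal.lean`.
Sources: H. Tasaki, *Physics and Mathematics of Quantum Many-Body Systems* (2020), App. A, §2.2;
O. Bratteli, D. W. Robinson, *Operator Algebras and Quantum Statistical Mechanics II*, §5.3.1.
Folklore linear algebra; no definition is introduced.
-/

noncomputable section

open scoped Matrix.Norms.L2Operator ComplexOrder MatrixOrder InnerProductSpace

namespace Summit.HubbardSuperconductivity.HubbardSuperconductivity.Theorems

open Matrix Filter Topology Literature.MathematicalPhysics.QuantumLattice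

/-! ### Orthogonal projections onto invariant subspaces -/

section SectorGibbs

variable {n : Type*} [Fintype n] [DecidableEq n]

/-- `P_K v = 0` for `v ⊥ K` (`Submodule.starProjection_apply_eq_zero_iff`, transported along
`projMatrix_mulVec`). [folklore] -/
theorem projMatrix_map_mulVec_eq_zero_of_forall (K : Submodule ℂ (n → ℂ)) {v : n → ℂ}
    (hv : ∀ w ∈ K, star w ⬝ᵥ v = 0) :
    projMatrix (K.map ((WithLp.linearEquiv 2 ℂ (n → ℂ)).symm :
      (n → ℂ) →ₗ[ℂ] EuclideanSpace ℂ n)) *ᵥ v = 0 := by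
  set K' := K.map ((WithLp.linearEquiv 2 ℂ (n → ℂ)).symm : (n → ℂ) →ₗ[ℂ] EuclideanSpace ℂ n)
    with hK'
  have h1 := projMatrix_mulVec K' (WithLp.toLp 2 v)
  rw [WithLp.ofLp_toLp] at h1
  rw [h1]
  have h2 : K'.starProjection (WithLp.toLp 2 v) = 0 := by
    rw [Submodule.starProjection_apply_eq_zero_iff, Submodule.mem_orthogonal]
    intro u hu
    rw [hK', mem_map_withLpLinearEquiv_symm_iff] at hu
    rw [EuclideanSpace.inner_eq_star_dotProduct, WithLp.ofLp_toLp, dotProduct_comm]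
    exact hv _ hu
  rw [h2, WithLp.ofLp_zero]

/-- If a Hermitian `H` leaves `K` invariant then it commutes with the orthogonal projection `P_K`
(`H P = P H P` because `H` maps `range P = K` into `K`; take adjoints). [folklore] -/
theorem projMatrix_map_mul_eq_mul_of_invariant {H : Matrix n n ℂ} (hH : H.IsHermitian)
    (K : Submodule ℂ (n → ℂ)) (hinv : ∀ v ∈ K, H *ᵥ v ∈ K) :
    projMatrix (K.map ((WithLp.linearEquiv 2 ℂ (n → ℂ)).symm :
        (n → ℂ) →ₗ[ℂ] EuclideanSpace ℂ n)) * H =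
      H * projMatrix (K.map ((WithLp.linearEquiv 2 ℂ (n → ℂ)).symm :
        (n → ℂ) →ₗ[ℂ] EuclideanSpace ℂ n)) := by
  set P := projMatrix (K.map ((WithLp.linearEquiv 2 ℂ (n → ℂ)).symm :
    (n → ℂ) →ₗ[ℂ] EuclideanSpace ℂ n)) with hP
  have hPh : P.IsHermitian := projMatrix_isHermitian _
  have h1 : H * P = P * H * P := by
    refine Matrix.toLin'.injective (LinearMap.ext fun v => ?_)
    simp only [Matrix.toLin'_apply, ← mulVec_mulVec]
    exact (projMatrix_map_mulVec_of_mem K (hinv _ (projMatrix_map_mulVec_mem K v))).symm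
  calc P * H = (H * P)ᴴ := by rw [conjTranspose_mul, hPh.eq, hH.eq]
    _ = (P * H * P)ᴴ := by rw [← h1]
    _ = P * H * P := by rw [conjTranspose_mul, conjTranspose_mul, hPh.eq, hH.eq, Matrix.mul_assoc]
    _ = H * P := h1.symm

/-- The sector energy `minEnergyOn H K` (an infimum of Rayleigh quotients) bounds the Rayleigh
quotient of every unit vector of `K` from below (the Rayleigh set is bounded below by the ground
energy, `Matrix.groundEnergy_le_rayleigh_holds`). Tasaki (2020) §2.2. [folklore] -/
theorem minEnergyOn_le_re_of_mem {H : Matrix n n ℂ} (hH : H.IsHermitian)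
    (K : Submodule ℂ (n → ℂ)) {ψ : n → ℂ} (hψ : ψ ∈ K) (h1 : star ψ ⬝ᵥ ψ = 1) :
    H.minEnergyOn K ≤ (star ψ ⬝ᵥ H *ᵥ ψ).re := by
  refine csInf_le ⟨H.groundEnergy, ?_⟩ ⟨ψ, hψ, h1, rfl⟩
  rintro E ⟨φ, -, hφ1, rfl⟩
  exact Matrix.groundEnergy_le_rayleigh_holds hH φ hφ1

/-- An eigenvector of `H` with eigenvalue strictly below the sector energy `minEnergyOn H K` of an
invariant subspace `K` is annihilated by `P_K`: `P_K u ∈ K` is again a `μ`-eigenvector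
(`P_K` commutes with `H`), and a nonzero one would have Rayleigh quotient `μ < minEnergyOn H K`.
[folklore] -/
theorem projMatrix_map_mulVec_eq_zero_of_eigenvalue_lt {H : Matrix n n ℂ} (hH : H.IsHermitian)
    (K : Submodule ℂ (n → ℂ)) (hinv : ∀ v ∈ K, H *ᵥ v ∈ K) {u : n → ℂ} {μ : ℝ}
    (hu : H *ᵥ u = (μ : ℂ) • u) (hμ : μ < H.minEnergyOn K) :
    projMatrix (K.map ((WithLp.linearEquiv 2 ℂ (n → ℂ)).symm :
      (n → ℂ) →ₗ[ℂ] EuclideanSpace ℂ n)) *ᵥ u = 0 := by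
  set P := projMatrix (K.map ((WithLp.linearEquiv 2 ℂ (n → ℂ)).symm :
    (n → ℂ) →ₗ[ℂ] EuclideanSpace ℂ n)) with hP
  by_contra hne
  have hwK : P *ᵥ u ∈ K := projMatrix_map_mulVec_mem K u
  have hHw : H *ᵥ (P *ᵥ u) = (μ : ℂ) • (P *ᵥ u) := by
    rw [mulVec_mulVec, hP, ← projMatrix_map_mul_eq_mul_of_invariant hH K hinv, ← mulVec_mulVec,
      hu, mulVec_smul]
  obtain ⟨c, -, hc1⟩ := exists_smul_unit hne
  have hmem : c • (P *ᵥ u) ∈ K := K.smul_mem c hwK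
  have hle := minEnergyOn_le_re_of_mem hH K hmem hc1
  have hray : (star (c • (P *ᵥ u)) ⬝ᵥ H *ᵥ (c • (P *ᵥ u))).re = μ := by
    rw [mulVec_smul, hHw, smul_smul, mul_comm, ← smul_smul, dotProduct_smul, hc1, smul_eq_mul,
      mul_one, Complex.ofReal_re]
  rw [hray] at hle
  exact absurd hle (not_le.mpr hμ)

omit [DecidableEq n] in
/-- Eigenvectors of a Hermitian matrix with distinct (real) eigenvalues are orthogonal
(`star w ⬝ᵥ u = 0`). [folklore] -/
theorem star_dotProduct_eq_zero_of_eigenvalue_ne {H : Matrix n n ℂ} (hH : H.IsHermitian)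
    {u w : n → ℂ} {μ ν : ℝ} (hu : H *ᵥ u = (μ : ℂ) • u) (hw : H *ᵥ w = (ν : ℂ) • w)
    (hne : ν ≠ μ) : star w ⬝ᵥ u = 0 := by
  have h1 : star w ⬝ᵥ (H *ᵥ u) = (μ : ℂ) * (star w ⬝ᵥ u) := by
    rw [hu, dotProduct_smul, smul_eq_mul]
  have h2 : star w ⬝ᵥ (H *ᵥ u) = (ν : ℂ) * (star w ⬝ᵥ u) := by
    rw [dotProduct_mulVec, ← conjTranspose_conjTranspose H, ← star_mulVec, hH.eq, hw, star_smul,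
      smul_dotProduct, Complex.star_def, Complex.conj_ofReal, smul_eq_mul]
  have h3 : ((ν : ℂ) - (μ : ℂ)) * (star w ⬝ᵥ u) = 0 := by rw [sub_mul, ← h1, ← h2, sub_self]
  exact (mul_eq_zero.1 h3).resolve_left (sub_ne_zero.2 fun h => hne (Complex.ofReal_inj.1 h))

/-- **The projection onto the sector ground eigenspace is `P_K` times the spectral projection.**
For a Hermitian `H` with eigenbasis `U = hH.eigenvectorUnitary`, an `H`-invariant subspace `K` and
`e₀ = minEnergyOn H K`: `P_K · U diag(𝟙[λᵢ = e₀]) U⋆ = P_{E₀}`, `E₀ = K ⊓ ker (H - e₀)`. (Check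
on the columns `bⱼ`: for `λⱼ ≠ e₀`, `bⱼ ⊥ E₀`; for `λⱼ = e₀`, `P_K bⱼ ∈ E₀` and `bⱼ - P_K bⱼ ⊥ K ⊇ E₀`,
so `P_K bⱼ` is the orthogonal projection of `bⱼ` onto `E₀`.) Tasaki (2020) App. A.2. [folklore] -/
theorem projMatrix_map_mul_conj_diagonal_eq {H : Matrix n n ℂ} (hH : H.IsHermitian)
    (K : Submodule ℂ (n → ℂ)) (hinv : ∀ v ∈ K, H *ᵥ v ∈ K) :
    projMatrix (K.map ((WithLp.linearEquiv 2 ℂ (n → ℂ)).symm :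
        (n → ℂ) →ₗ[ℂ] EuclideanSpace ℂ n)) *
      ((hH.eigenvectorUnitary : Matrix n n ℂ) *
        diagonal (fun i => if hH.eigenvalues i = H.minEnergyOn K then (1 : ℂ) else 0) *
          star (hH.eigenvectorUnitary : Matrix n n ℂ)) =
      projMatrix ((K ⊓ Module.End.eigenspace (Matrix.toLin' H) ((H.minEnergyOn K : ℝ) : ℂ)).map
        ((WithLp.linearEquiv 2 ℂ (n → ℂ)).symm : (n → ℂ) →ₗ[ℂ] EuclideanSpace ℂ n)) := by
  set e₀ : ℝ := H.minEnergyOn K with he₀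
  set E₀ : Submodule ℂ (n → ℂ) := K ⊓ Module.End.eigenspace (Matrix.toLin' H) ((e₀ : ℝ) : ℂ)
    with hE₀
  set K' := K.map ((WithLp.linearEquiv 2 ℂ (n → ℂ)).symm : (n → ℂ) →ₗ[ℂ] EuclideanSpace ℂ n)
    with hK'
  set E₀' := E₀.map ((WithLp.linearEquiv 2 ℂ (n → ℂ)).symm : (n → ℂ) →ₗ[ℂ] EuclideanSpace ℂ n)
    with hE₀'
  set P := projMatrix K' with hP
  set P₀ := projMatrix E₀' with hP₀
  set U : Matrix n n ℂ := (hH.eigenvectorUnitary : Matrix n n ℂ) with hU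
  have hUU : U * star U = 1 := Unitary.mul_star_self_of_mem hH.eigenvectorUnitary.prop
  -- the columns of `U` are eigenvectors
  have hcol : ∀ j, H *ᵥ (fun i => U i j) = ((hH.eigenvalues j : ℝ) : ℂ) • (fun i => U i j) := by
    intro j
    have h : (fun i => U i j) = ⇑(hH.eigenvectorBasis j) :=
      funext fun i => IsHermitian.eigenvectorUnitary_apply hH i j
    rw [h, hH.mulVec_eigenvectorBasis j, RCLike.real_smul_eq_coe_smul (K := ℂ)]
    rfl
  -- membership in `E₀`
  have hmemE₀ : ∀ w, w ∈ E₀ ↔ w ∈ K ∧ H *ᵥ w = ((e₀ : ℝ) : ℂ) • w := by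
    intro w
    rw [hE₀, Submodule.mem_inf, Module.End.mem_eigenspace_iff, Matrix.toLin'_apply]
  -- column-wise identity
  have key : ∀ j, (if hH.eigenvalues j = e₀ then (1 : ℂ) else 0) • (P *ᵥ fun i => U i j) =
      P₀ *ᵥ fun i => U i j := by
    intro j
    by_cases hj : hH.eigenvalues j = e₀
    · rw [if_pos hj, one_smul]
      -- `P bⱼ` is the orthogonal projection of `bⱼ` onto `E₀`
      have hmem : P *ᵥ (fun i => U i j) ∈ E₀ := by
        refine (hmemE₀ _).2 ⟨projMatrix_map_mulVec_mem K _, ?_⟩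
        rw [mulVec_mulVec, hP, hK', ← projMatrix_map_mul_eq_mul_of_invariant hH K hinv,
          ← mulVec_mulVec, hcol j, mulVec_smul, hj]
      have h1 := projMatrix_mulVec E₀' (WithLp.toLp 2 (fun i => U i j))
      rw [WithLp.ofLp_toLp] at h1
      rw [h1]
      have h2 : E₀'.starProjection (WithLp.toLp 2 fun i => U i j) =
          WithLp.toLp 2 (P *ᵥ fun i => U i j) := by
        apply Submodule.eq_starProjection_of_mem_of_inner_eq_zero
        · rw [hE₀', mem_map_withLpLinearEquiv_symm_iff, WithLp.ofLp_toLp]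
          exact hmem
        · intro w hw
          rw [hE₀', mem_map_withLpLinearEquiv_symm_iff] at hw
          have hwK : WithLp.ofLp w ∈ K := ((hmemE₀ _).1 hw).1
          -- `bⱼ - P bⱼ ⊥ K`
          have horth := Submodule.sub_starProjection_mem_orthogonal (K := K')
            (WithLp.toLp 2 fun i => U i j)
          rw [Submodule.mem_orthogonal'] at horth
          have h3 := horth w (by rw [hK', mem_map_withLpLinearEquiv_symm_iff]; exact hwK)
          have h4 : K'.starProjection (WithLp.toLp 2 fun i => U i j) =
              WithLp.toLp 2 (P *ᵥ fun i => U i j) := by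
            have h5 := projMatrix_mulVec K' (WithLp.toLp 2 (fun i => U i j))
            rw [WithLp.ofLp_toLp] at h5
            rw [hP, h5, WithLp.toLp_ofLp]
          rw [h4] at h3
          exact h3
      rw [h2, WithLp.ofLp_toLp]
    · rw [if_neg hj, zero_smul]
      symm
      apply projMatrix_map_mulVec_eq_zero_of_forall
      intro w hw
      obtain ⟨-, hw2⟩ := (hmemE₀ w).1 hw
      exact star_dotProduct_eq_zero_of_eigenvalue_ne hH (hcol j) hw2 (Ne.symm hj)
  -- assemble: `(P Π) U = P₀ U`, then cancel `U`
  have hPU : P * (U * diagonal (fun i => if hH.eigenvalues i = e₀ then (1 : ℂ) else 0)) =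
      P₀ * U := by
    ext i j
    have h1 : (P * (U * diagonal (fun i => if hH.eigenvalues i = e₀ then (1 : ℂ) else 0))) i j =
        (if hH.eigenvalues j = e₀ then (1 : ℂ) else 0) * (P *ᵥ fun i => U i j) i := by
      rw [← Matrix.mul_assoc, mul_diagonal, mul_comm]
      simp only [mul_apply, mulVec, dotProduct]
    have h2 : (P₀ * U) i j = (P₀ *ᵥ fun i => U i j) i := by
      simp only [mul_apply, mulVec, dotProduct]
    rw [h1, h2, ← key j, Pi.smul_apply, smul_eq_mul]
  calc P * (U * diagonal (fun i => if hH.eigenvalues i = e₀ then (1 : ℂ) else 0) * star U)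
        = P * (U * diagonal (fun i => if hH.eigenvalues i = e₀ then (1 : ℂ) else 0)) * star U := by
          rw [← Matrix.mul_assoc]
    _ = P₀ * U * star U := by rw [hPU]
    _ = P₀ := by rw [Matrix.mul_assoc, hUU, Matrix.mul_one]

/-! ### The zero-temperature limit of the sector Gibbs state -/

/-- **Zero-temperature limit of the canonical (sector) Gibbs state.** For a Hermitian `H`, an
`H`-invariant subspace `K` with sector energy `e₀ = minEnergyOn H K` and sector ground eigenspace
`E₀ = K ⊓ ker (H - e₀) ≠ ⊥`, the sector Gibbs average `tr (P_K e^{-βH} A) / tr (P_K e^{-βH})`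
tends, as `β → ∞`, to the uniform ground-eigenspace average `tr (P_{E₀} A) / tr P_{E₀}`
(eigenbasis `e^{-βH} = U diag(e^{-βλᵢ}) U⋆`; columns with `λᵢ < e₀` are killed by `P_K`, the
factor `e^{-βe₀}` cancels, `e^{-β(λᵢ-e₀)} → 𝟙[λᵢ = e₀]`, and `P_K · U diag(𝟙[λᵢ = e₀]) U⋆ = P_{E₀}`).
"The ground states of a sector are the `β ↑ ∞` limit of its canonical equilibrium state."
Tasaki (2020) App. A, §2.2; Bratteli–Robinson II §5.3.1. [folklore] -/
theorem tendsto_sectorGibbs_atTop {H : Matrix n n ℂ} (hH : H.IsHermitian)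
    (K : Submodule ℂ (n → ℂ)) (hinv : ∀ v ∈ K, H *ᵥ v ∈ K)
    (hE₀ : K ⊓ Module.End.eigenspace (Matrix.toLin' H) ((H.minEnergyOn K : ℝ) : ℂ) ≠ ⊥)
    (A : Matrix n n ℂ) :
    Tendsto (fun β : ℝ =>
        (projMatrix (K.map ((WithLp.linearEquiv 2 ℂ (n → ℂ)).symm :
            (n → ℂ) →ₗ[ℂ] EuclideanSpace ℂ n)) * gibbsWeight β H * A).trace /
          (projMatrix (K.map ((WithLp.linearEquiv 2 ℂ (n → ℂ)).symm :
            (n → ℂ) →ₗ[ℂ] EuclideanSpace ℂ n)) * gibbsWeight β H).trace) atTop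
      (𝓝 ((projMatrix ((K ⊓ Module.End.eigenspace (Matrix.toLin' H)
            ((H.minEnergyOn K : ℝ) : ℂ)).map ((WithLp.linearEquiv 2 ℂ (n → ℂ)).symm :
              (n → ℂ) →ₗ[ℂ] EuclideanSpace ℂ n)) * A).trace /
        (projMatrix ((K ⊓ Module.End.eigenspace (Matrix.toLin' H)
            ((H.minEnergyOn K : ℝ) : ℂ)).map ((WithLp.linearEquiv 2 ℂ (n → ℂ)).symm :
              (n → ℂ) →ₗ[ℂ] EuclideanSpace ℂ n))).trace)) := by
  set e₀ : ℝ := H.minEnergyOn K with he₀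
  set E₀ : Submodule ℂ (n → ℂ) := K ⊓ Module.End.eigenspace (Matrix.toLin' H) ((e₀ : ℝ) : ℂ)
    with hE₀def
  set P := projMatrix (K.map ((WithLp.linearEquiv 2 ℂ (n → ℂ)).symm :
    (n → ℂ) →ₗ[ℂ] EuclideanSpace ℂ n)) with hP
  set P₀ := projMatrix (E₀.map ((WithLp.linearEquiv 2 ℂ (n → ℂ)).symm :
    (n → ℂ) →ₗ[ℂ] EuclideanSpace ℂ n)) with hP₀
  set U : Matrix n n ℂ := (hH.eigenvectorUnitary : Matrix n n ℂ) with hU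
  -- truncated, rescaled Boltzmann weights, their limits, and `W β = U diag(d β) U⋆`
  let d : ℝ → n → ℂ := fun β i =>
    if hH.eigenvalues i < e₀ then 0 else (Real.exp (-(β * (hH.eigenvalues i - e₀))) : ℂ)
  let dinf : n → ℂ := fun i => if hH.eigenvalues i = e₀ then 1 else 0
  let W : ℝ → Matrix n n ℂ := fun β => U * diagonal (d β) * star U
  -- the columns of `U` are eigenvectors; those below `e₀` are killed by `P`
  have hcol : ∀ j, H *ᵥ (fun i => U i j) = ((hH.eigenvalues j : ℝ) : ℂ) • (fun i => U i j) := by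
    intro j
    have h : (fun i => U i j) = ⇑(hH.eigenvectorBasis j) :=
      funext fun i => IsHermitian.eigenvectorUnitary_apply hH i j
    rw [h, hH.mulVec_eigenvectorBasis j, RCLike.real_smul_eq_coe_smul (K := ℂ)]
    rfl
  have hPU0 : ∀ i j, hH.eigenvalues j < e₀ → (P * U) i j = 0 := by
    intro i j hj
    have h := projMatrix_map_mulVec_eq_zero_of_eigenvalue_lt hH K hinv (hcol j) hj
    have h2 : (P * U) i j = (P *ᵥ fun k => U k j) i := by
      simp only [mul_apply, mulVec, dotProduct]
    rw [h2, hP, h, Pi.zero_apply]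
  -- (1) `P e^{-βH} = e^{-βe₀} • P (W β)`
  have hG : ∀ β, P * gibbsWeight β H = (Real.exp (-(β * e₀)) : ℂ) • (P * W β) := by
    intro β
    have hsmul : (-(β : ℂ) • H : Matrix n n ℂ) = (-β : ℝ) • H := by
      ext i j
      simp [Matrix.smul_apply, Complex.real_smul]
    have h1 : gibbsWeight β H = cfc (fun x : ℝ => Real.exp ((-β) • x)) H := by
      rw [gibbsWeight, hsmul, cfc_comp_smul (-β) Real.exp H, CFC.real_exp_eq_normedSpace_exp]
    have h2 : gibbsWeight β H =
        U * diagonal (fun i => (Real.exp (-(β * hH.eigenvalues i)) : ℂ)) * star U := by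
      rw [h1, hH.cfc_eq, IsHermitian.cfc, Unitary.conjStarAlgAut_apply]
      simp only [smul_eq_mul, neg_mul]
      rfl
    have h3 : P * U * diagonal (fun i => (Real.exp (-(β * hH.eigenvalues i)) : ℂ)) =
        (Real.exp (-(β * e₀)) : ℂ) • (P * U * diagonal (d β)) := by
      ext i j
      rw [Matrix.smul_apply, mul_diagonal, mul_diagonal, smul_eq_mul]
      by_cases hj : hH.eigenvalues j < e₀
      · rw [hPU0 i j hj, zero_mul, zero_mul, mul_zero]
      · simp only [d, if_neg hj]
        rw [mul_left_comm, ← Complex.ofReal_mul, ← Real.exp_add]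
        have : -(β * e₀) + -(β * (hH.eigenvalues j - e₀)) = -(β * hH.eigenvalues j) := by ring
        rw [this]
    calc P * gibbsWeight β H
          = P * U * diagonal (fun i => (Real.exp (-(β * hH.eigenvalues i)) : ℂ)) * star U := by
            rw [h2, ← Matrix.mul_assoc, ← Matrix.mul_assoc]
      _ = (Real.exp (-(β * e₀)) : ℂ) • (P * W β) := by
            rw [h3, Matrix.smul_mul]
            congr 1
            simp only [W, Matrix.mul_assoc]
  -- (2) the scalar cancels in the sector Gibbs average
  have hratio : ∀ β, (P * gibbsWeight β H * A).trace / (P * gibbsWeight β H).trace =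
      (P * W β * A).trace / (P * W β).trace := by
    intro β
    have hc : (Real.exp (-(β * e₀)) : ℂ) ≠ 0 := Complex.ofReal_ne_zero.2 (Real.exp_pos _).ne'
    rw [hG β, Matrix.smul_mul, trace_smul, trace_smul, smul_eq_mul, smul_eq_mul,
      mul_div_mul_left _ _ hc]
  -- (3) `d β → dinf` entrywise
  have hd : Tendsto d atTop (𝓝 dinf) := by
    rw [tendsto_pi_nhds]
    intro i
    by_cases hlt : hH.eigenvalues i < e₀
    · have h0 : (fun β => d β i) = fun _ => (0 : ℂ) := by funext β; simp [d, hlt]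
      rw [h0]
      simp only [dinf, if_neg hlt.ne]
      exact tendsto_const_nhds
    · by_cases hi : hH.eigenvalues i = e₀
      · have h0 : (fun β => d β i) = fun _ => (1 : ℂ) := by funext β; simp [d, hi]
        rw [h0]
        simp only [dinf, if_pos hi]
        exact tendsto_const_nhds
      · have hgt : e₀ < hH.eigenvalues i := lt_of_le_of_ne (not_lt.1 hlt) (Ne.symm hi)
        have h1 : Tendsto (fun β : ℝ => β * (hH.eigenvalues i - e₀)) atTop atTop :=
          tendsto_id.atTop_mul_const (sub_pos.2 hgt)
        have h2 := (Complex.continuous_ofReal.tendsto 0).comp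
          (Real.tendsto_exp_neg_atTop_nhds_zero.comp h1)
        have h0 : (fun β => d β i) =
            fun β => ((Real.exp (-(β * (hH.eigenvalues i - e₀))) : ℝ) : ℂ) := by
          funext β; simp [d, hlt]
        rw [h0]
        simp only [dinf, if_neg hi]
        simpa [Function.comp_def] using h2
  -- (4) hence `P W β → P₀`, the traces converge, and `tr P₀ ≠ 0`
  have hφ : Continuous fun v : n → ℂ => U * diagonal v * star U :=
    (continuous_const.matrix_mul continuous_id.matrix_diagonal).matrix_mul continuous_const
  have hW : Tendsto W atTop (𝓝 (U * diagonal dinf * star U)) := (hφ.tendsto dinf).comp hd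
  have hlim : P * (U * diagonal dinf * star U) = P₀ :=
    projMatrix_map_mul_conj_diagonal_eq hH K hinv
  have htr : Tendsto (fun β => (P * W β).trace) atTop (𝓝 P₀.trace) := by
    rw [← hlim]
    exact ((continuous_const.matrix_mul continuous_id).matrix_trace.tendsto _).comp hW
  have htrA : Tendsto (fun β => (P * W β * A).trace) atTop (𝓝 (P₀ * A).trace) := by
    rw [← hlim]
    exact (((continuous_const.matrix_mul continuous_id).matrix_mul
      continuous_const).matrix_trace.tendsto _).comp hW
  have hne : P₀.trace ≠ 0 := by
    rw [hP₀, trace_projMatrix_map, Nat.cast_ne_zero, ← Nat.one_le_iff_ne_zero]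
    exact Submodule.one_le_finrank_iff.mpr hE₀
  have hfun : (fun β : ℝ => (P * gibbsWeight β H * A).trace / (P * gibbsWeight β H).trace) =
      fun β => (P * W β * A).trace / (P * W β).trace :=
    funext hratio
  rw [hfun]
  exact htrA.div htr hne

/-- **Eventual thermal lower bound ⇒ ground-eigenspace-average bound.** Under the hypotheses of
`tendsto_sectorGibbs_atTop`, if `c ≤ re (tr (P_K e^{-βH} A) / tr (P_K e^{-βH}))` for all large
`β`, then `c · re tr P_{E₀} ≤ re tr (P_{E₀} A)` (pass to the limit; `tr P_{E₀} = dim E₀ ≥ 1`).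
Tasaki (2020) App. A. [folklore] -/
theorem mul_re_trace_le_of_eventually_sectorGibbs {H : Matrix n n ℂ} (hH : H.IsHermitian)
    (K : Submodule ℂ (n → ℂ)) (hinv : ∀ v ∈ K, H *ᵥ v ∈ K)
    (hE₀ : K ⊓ Module.End.eigenspace (Matrix.toLin' H) ((H.minEnergyOn K : ℝ) : ℂ) ≠ ⊥)
    (A : Matrix n n ℂ) (c : ℝ)
    (h : ∀ᶠ β : ℝ in atTop, c ≤
      ((projMatrix (K.map ((WithLp.linearEquiv 2 ℂ (n → ℂ)).symm :
            (n → ℂ) →ₗ[ℂ] EuclideanSpace ℂ n)) * gibbsWeight β H * A).trace /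
        (projMatrix (K.map ((WithLp.linearEquiv 2 ℂ (n → ℂ)).symm :
            (n → ℂ) →ₗ[ℂ] EuclideanSpace ℂ n)) * gibbsWeight β H).trace).re) :
    c * (projMatrix ((K ⊓ Module.End.eigenspace (Matrix.toLin' H)
            ((H.minEnergyOn K : ℝ) : ℂ)).map ((WithLp.linearEquiv 2 ℂ (n → ℂ)).symm :
              (n → ℂ) →ₗ[ℂ] EuclideanSpace ℂ n))).trace.re ≤
      (projMatrix ((K ⊓ Module.End.eigenspace (Matrix.toLin' H)
            ((H.minEnergyOn K : ℝ) : ℂ)).map ((WithLp.linearEquiv 2 ℂ (n → ℂ)).symm :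
              (n → ℂ) →ₗ[ℂ] EuclideanSpace ℂ n)) * A).trace.re := by
  have hlim := tendsto_sectorGibbs_atTop hH K hinv hE₀ A
  set E₀ : Submodule ℂ (n → ℂ) := K ⊓ Module.End.eigenspace (Matrix.toLin' H)
    ((H.minEnergyOn K : ℝ) : ℂ) with hE₀def
  set P₀ := projMatrix (E₀.map ((WithLp.linearEquiv 2 ℂ (n → ℂ)).symm :
    (n → ℂ) →ₗ[ℂ] EuclideanSpace ℂ n)) with hP₀
  have hre := (Complex.continuous_re.tendsto _).comp hlim
  have hc : c ≤ ((P₀ * A).trace / P₀.trace).re := ge_of_tendsto hre h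
  have htr : P₀.trace = (Module.finrank ℂ E₀ : ℂ) := trace_projMatrix_map E₀
  have hm : (0 : ℝ) < (Module.finrank ℂ E₀ : ℝ) :=
    Nat.cast_pos.mpr (Submodule.one_le_finrank_iff.mpr hE₀)
  rw [htr, Complex.div_natCast_re] at hc
  rw [htr, Complex.natCast_re]
  exact (le_div_iff₀ hm).mp hc

end SectorGibbs

end Summit.HubbardSuperconductivity.HubbardSuperconductivity.Theorems
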